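import Summits.Ventures.GridStability.Models.InverterDVOCInstances
import Summits.Ventures.GridStability.Bench.DVOC2GCBD19Deg2AQ13Roa

/-!
# GridStability/Models/InverterDVOCGcbd19n13Roa — rung G3.c TRACK S «DVOC2-GCBD19-13»: the -roa sentence ON THE CONVERTER NETWORK MODEL (hypothesis-free)

Cell `gridfusion` (LADDER-GRIDFUSION, APEX LINE rung G3.c, director RULING 16 (c) / RULING 18 Track S;
lead A20/A29: instance of record «DVOC2-GCBD19-13»; boxes D sos-3 j262640 · A certnum-sdp-3 /
sos-1 · B sos-2 j263790 · Lean sos-3 p485467/p485806 (`Bench/DVOC2GCBD19Deg2AQ13{Data,}.lean`) ·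
-roa (quotient coordinates) lyap-1 `Bench/DVOC2GCBD19Deg2AQ13Roa.lean` · model-side transport
model-3); seat gridfusion-model-3 (g4). This file is the LAST LINK of the Track S chain: it composes
* lyap-1's `Bench.DVOC2GCBD19.deg2_A_q13_roa` — for every level `0 < γ ≤ 2247/1000`, every curve of
  the recast system `ż = F(z)` on `[0, ∞)` staying in `M = {h̃ = 0} ∩ {z₀ + 1 ≥ 0} ∩ {z₁ + 1 ≥ 0}`
  with `V(z 0) ≤ γ` keeps `V ≤ γ` and tends to `0` (from the two kernel-checked SOS identities
  `deg2_A_q13_V_pos` / `deg2_A_q13_Vdot_neg` of the Bench file), with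
* model-3's instance transport `gcbd19n13.invariants_tendsto_of_quotient_roa` (p479828, over the
  generic `DvocNetwork.invariants_tendsto_of_quotient_roa` p478570 and the quotient calculus p467971),
by discharging its two remaining hypotheses once and for all:
* `deg2_A_q13_F_eq_Gtilde` : the Bench field `F` IS model-4's shifted quotient field `G̃` of the
  typed instance (`fin_cases`/`simp`/`ring` against the Bench `…_f_*_eq` lemmas) — hence, with
  `gcbd19n13.Gtilde_sub_rstar`, `F (r − r⋆) = quotField gcbd19n13 r`;
* `invariants_sub_rstar_mem_M` : every shifted invariant vector `invariants v̂ − r⋆` of a network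
  state lies in lyap-1's `M` (`deg2_A_q13_h_eq_shiftedQuadric`: sos-3's `h̃` is EXACTLY the shifted
  rank-one syzygy `(x₂ + ξ⋆)² + (x₃ + ζ⋆)² − (x₀ + 1)(x₁ + 1)`, using `ξ⋆² + ζ⋆² = 1`; the orthant
  conjuncts are `ρ_k = ‖v̂_k‖² ≥ 0`) — for ALL times, so no invariance argument is needed anywhere.

RESULT (`deg2_A_q13_invariants_tendsto`, `deg2_A_q13_rho_xi_zeta_tendsto`, `deg2_A_q13_orbit_roa`):
along EVERY solution `v̂ : [0, ∞) → (ℝ²)²` of the reduced dVOC network model «DVOC2-GCBD19-13»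
(`gcbd19n13.IsSolutionOn v̂ (Ici 0)`, tree convention) whose initial rotation invariants satisfy
`V(invariants v̂(0) − r⋆) ≤ γ` for some `0 < γ ≤ 2247/1000`: the bound persists for all `t ≥ 0` and
`‖v̂₀(t)‖² → 1`, `‖v̂₁(t)‖² → 1`, `⟨v̂₀, v̂₁⟩(t) → 16787363/16799845`, `v̂₀ ∧ v̂₁ (t) → 647484/16799845`
— the state approaches the rest ORBIT `{v̂ | invariants v̂ = r⋆}` = `{ℛ(θ) v̂⋆ | θ}` of the
rotation-equivariant model (`field_rotate`, `invariants_rotate`), i.e. both converters reach nominal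
magnitude and the dispatched angle difference `θ₀₁⋆` (`cos θ⋆ = 16787363/16799845`,
`sin θ⋆ = 647484/16799845`). `deg2_A_q13_box_subset`: the certified region is not thin — every state
whose four invariants are each within `9/10` of their rest values (in particular every state with
`‖v̂_k‖² ∈ [1/10, 19/10]` and `|⟨v̂₀,v̂₁⟩ − ξ⋆|, |v̂₀∧v̂₁ − ζ⋆| ≤ 9/10`) satisfies `V ≤ 2247/1000`.

THREE COLUMNS. CERTIFIED (kernel, Bench file p485467/p485806, toolchain A ≡ D claim instance
438044cc744eb601, B twin sos-2 j263790): the two SOS identities. MODELLED: every sentence of this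
file is about the reduced dVOC network ODE `d v̂/dt = f^s(v̂)` [cite: SuboticEtAl2021, eq. (ss.f.vhat)]
= [cite: GrossEtAl2019, eq. (17)] (bridge p477842) at the instance «DVOC2-GCBD19-13» — MODEL-VALIDITY
MV-6O + MV-κ(κ′) + MV-P + N2-restriction(-13) (model-2 00:00:53Z): two of the three printed
converters of [cite: GrossEtAl2019, §V-A] over the printed 25-km line, controller angle
`κ′ = arcsin(160401/161201)`, A1 set-points; a model-4 CONSTRUCTION from the printed case, declared.
VALIDATED (model-4, float, not used): tangential spectrum `{−0.111, −0.081, −0.030}`, RK4 → `r⋆`.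
SOS certificates are sufficient, not necessary; the region is an INNER estimate of the model's
region of orbital attraction. No sentence of this file says a converter or a grid is stable.
-/

noncomputable section

open Real Set Filter Topology

namespace Summit.Ventures.GridStability.Models.InverterDVOC.DvocNetwork.gcbd19n13

open Summit.Ventures.GridStability.Bench.DVOC2GCBD19

/-! ## §1 The two glue identities -/

/-- **The Bench field IS the typed instance's shifted quotient field**: lyap-1's recast field
`deg2_A_q13_F` (components = sos-3's emitted `deg2_A_q13_f_*`) equals model-4's `G̃` typed in
`gcbd19n13.Gtilde` (p479828) — coefficient by coefficient (`…_f_*_eq` + `ring`). [folklore] -/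
theorem deg2_A_q13_F_eq_Gtilde (z : Fin 4 → ℝ) : deg2_A_q13_F z = Gtilde z := by
  ext i
  fin_cases i <;>
    simp [deg2_A_q13_F, deg2_A_q13_f_rho_0_eq, deg2_A_q13_f_rho_1_eq, deg2_A_q13_f_xi_eq,
      deg2_A_q13_f_zeta_eq, Gtilde] <;> ring

/-- Hence the `hF`-shape of the generic transport: `F (r − r⋆) = quotField gcbd19n13 r`. [folklore] -/
theorem deg2_A_q13_F_sub_rstar (r : Fin 4 → ℝ) : deg2_A_q13_F (r - rstar) = gcbd19n13.quotField r := by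
  rw [deg2_A_q13_F_eq_Gtilde, Gtilde_sub_rstar]

/-- **sos-3's constraint `h̃` IS the shifted rank-one syzygy** of the rotation invariants:
`h̃(x) = (x₂ + ξ⋆)² + (x₃ + ζ⋆)² − (x₀ + 1)(x₁ + 1)` (uses `ξ⋆² + ζ⋆² = 1`, `rstar_mem_quadric`).
[folklore] -/
theorem deg2_A_q13_h_eq_shiftedQuadric (x : Fin 4 → ℝ) :
    deg2_A_q13_h (x 0) (x 1) (x 2) (x 3)
      = (x 2 + rstar 2) ^ 2 + (x 3 + rstar 3) ^ 2 - (x 0 + 1) * (x 1 + 1) := by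
  rw [deg2_A_q13_h_eq]
  simp only [rstar, Matrix.cons_val]
  ring

/-- **Every shifted invariant vector of a network state lies in lyap-1's constraint set `M`**
(`{h̃ = 0} ∩ {x₀ + 1 ≥ 0} ∩ {x₁ + 1 ≥ 0}`): the syzygy `ξ² + ζ² = ρ₀ρ₁` and `ρ_k = ‖v̂_k‖² ≥ 0`
(`invariants_sub_rstar_mem`, p479828). This is the transport's `hM`, valid at EVERY time along every
network curve — no invariance argument is needed for the orthant conjuncts. [folklore] -/
theorem invariants_sub_rstar_mem_M (v : State 2) : invariants v - rstar ∈ deg2_A_q13_M := by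
  obtain ⟨hq, h0, h1⟩ := invariants_sub_rstar_mem v
  refine ⟨?_, h0, h1⟩
  rw [deg2_A_q13_h_eq_shiftedQuadric, hq, sub_self]

/-! ## §2 lyap-1's quotient roa in the transport's shape, and the network sentence -/

/-- lyap-1's `deg2_A_q13_roa` restated with the field written as `G̃` (the `hroa` hypothesis of
`gcbd19n13.invariants_tendsto_of_quotient_roa`, verbatim). MODELLED: the shifted rotation-quotient
ODE `ẋ = G̃(x)` of «DVOC2-GCBD19-13». [folklore] -/
theorem deg2_A_q13_quotient_roa {γ : ℝ} (hγ0 : 0 < γ) (hγ : γ ≤ deg2_A_q13_level) :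
    ∀ x : ℝ → Fin 4 → ℝ, ContinuousOn x (Ici 0) →
      (∀ t, 0 ≤ t → HasDerivWithinAt x (Gtilde (x t)) (Ici t) t) →
      (∀ t, 0 ≤ t → x t ∈ deg2_A_q13_M) →
      deg2_A_q13_Vz (x 0) ≤ γ → (∀ t, 0 ≤ t → deg2_A_q13_Vz (x t) ≤ γ) ∧ Tendsto x atTop (𝓝 0) := by
  intro x hxc hx hxM hx0
  exact deg2_A_q13_roa hγ0 hγ x hxc (fun t ht => by rw [deg2_A_q13_F_eq_Gtilde]; exact hx t ht) hxM hx0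

/-- **Rung G3.c Track S — the -roa sentence on the converter network model «DVOC2-GCBD19-13»
(hypothesis-free).** For every level `0 < γ ≤ 2247/1000` and EVERY solution `v̂` of the reduced dVOC
network `d v̂/dt = f^s(v̂)` (`gcbd19n13 : DvocNetwork 2`) on `[0, ∞)` with
`V(invariants v̂(0) − r⋆) ≤ γ`: `V(invariants v̂(t) − r⋆) ≤ γ` for all `t ≥ 0` (the certified tube
around the rest orbit is positively invariant) and `invariants v̂(t) → r⋆ = (1, 1, 16787363/16799845,
647484/16799845)`. CERTIFIED inputs: `deg2_A_q13_V_pos`, `deg2_A_q13_Vdot_neg` (via lyap-1's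
`deg2_A_q13_roa`). MODELLED: MV-6O + MV-κ(κ′) + MV-P + N2-restriction(-13)
[cite: SuboticEtAl2021, eq. (ss.f.vhat)] [cite: GrossEtAl2019, §V-A]. Inner estimate; no sentence
here says a converter or a grid is stable. [folklore] -/
theorem deg2_A_q13_invariants_tendsto {γ : ℝ} (hγ0 : 0 < γ) (hγ : γ ≤ deg2_A_q13_level)
    {v : ℝ → State 2} (hv : gcbd19n13.IsSolutionOn v (Ici 0))
    (h0 : deg2_A_q13_Vz (invariants (v 0) - rstar) ≤ γ) :
    (∀ t, 0 ≤ t → deg2_A_q13_Vz (invariants (v t) - rstar) ≤ γ) ∧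
      Tendsto (fun t => invariants (v t)) atTop (𝓝 rstar) :=
  invariants_tendsto_of_quotient_roa invariants_sub_rstar_mem_M (deg2_A_q13_quotient_roa hγ0 hγ) hv h0

/-- **The same, unpacked in the model's quantities**: `‖v̂₀(t)‖² → 1`, `‖v̂₁(t)‖² → 1`,
`⟨v̂₀, v̂₁⟩(t) → cos θ₀₁⋆ = 16787363/16799845`, `v̂₀ ∧ v̂₁ (t) → sin θ₀₁⋆ = 647484/16799845` — both
converters of the MODEL reach nominal magnitude and the dispatched angle difference: convergence to
the rest ORBIT `{ℛ(θ) v̂⋆}` (certified inner-estimate form, for the reduced model at this instance,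
of the set statement [cite: SuboticEtAl2021, Thm. 6]). MODELLED: MV-6O + MV-κ(κ′) + MV-P +
N2-restriction(-13). No stability word. [folklore] -/
theorem deg2_A_q13_rho_xi_zeta_tendsto {γ : ℝ} (hγ0 : 0 < γ) (hγ : γ ≤ deg2_A_q13_level)
    {v : ℝ → State 2} (hv : gcbd19n13.IsSolutionOn v (Ici 0))
    (h0 : deg2_A_q13_Vz (invariants (v 0) - rstar) ≤ γ) :
    Tendsto (fun t => rho (v t) 0) atTop (𝓝 1) ∧
      Tendsto (fun t => rho (v t) 1) atTop (𝓝 1) ∧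
      Tendsto (fun t => xi (v t) 0 1) atTop (𝓝 (16787363 / 16799845)) ∧
      Tendsto (fun t => zeta (v t) 0 1) atTop (𝓝 (647484 / 16799845)) := by
  have h := rho_xi_zeta_tendsto_of_quotient_roa gcbd19n13 rstar deg2_A_q13_F_sub_rstar
    invariants_sub_rstar_mem_M (deg2_A_q13_roa hγ0 hγ) hv h0
  simpa [rstar] using h

/-- **Level-of-record form** (`γ = c = 2247/1000`): every solution of the network model on
`[0, ∞)` starting in the certified tube `{V(invariants − r⋆) ≤ 2247/1000}` stays in it and its
invariants tend to `r⋆`. MODELLED as above; no stability word. [folklore] -/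
theorem deg2_A_q13_orbit_roa {v : ℝ → State 2} (hv : gcbd19n13.IsSolutionOn v (Ici 0))
    (h0 : deg2_A_q13_Vz (invariants (v 0) - rstar) ≤ deg2_A_q13_level) :
    (∀ t, 0 ≤ t → deg2_A_q13_Vz (invariants (v t) - rstar) ≤ deg2_A_q13_level) ∧
      Tendsto (fun t => invariants (v t)) atTop (𝓝 rstar) :=
  deg2_A_q13_invariants_tendsto (by simp only [deg2_A_q13_level]; norm_num) le_rfl hv h0

/-! ## §3 The certified tube is not thin: an explicit box of invariants inside `{V ≤ c}` -/

/-- **Explicit inner box.** Every shifted invariant vector with `|x_i| ≤ 9/10` for `i = 0, …, 3`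
has `V(x) ≤ 2247/1000` (`V` = the certificate's quadratic-plus-linear Lyapunov function; crude
termwise bound `Σ|q_ij|·(9/10)² + Σ|ℓ_i|·(9/10) < 2.16`). Read on the model: every state with
`‖v̂_k‖² ∈ [1/10, 19/10]` (`k = 0, 1`), `|⟨v̂₀,v̂₁⟩ − ξ⋆| ≤ 9/10`, `|v̂₀∧v̂₁ − ζ⋆| ≤ 9/10` lies in the
certified tube of `deg2_A_q13_orbit_roa`. MODELLED as above. [folklore] -/
theorem deg2_A_q13_Vz_le_level_of_box {x : Fin 4 → ℝ} (hx : ∀ i, |x i| ≤ 9 / 10) :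
    deg2_A_q13_Vz x ≤ deg2_A_q13_level := by
  have a0 : 0 ≤ 9 / 10 + x 0 := by have := (abs_le.1 (hx 0)).1; linarith
  have s0 : 0 ≤ 9 / 10 - x 0 := by have := (abs_le.1 (hx 0)).2; linarith
  have a1 : 0 ≤ 9 / 10 + x 1 := by have := (abs_le.1 (hx 1)).1; linarith
  have s1 : 0 ≤ 9 / 10 - x 1 := by have := (abs_le.1 (hx 1)).2; linarith
  have a2 : 0 ≤ 9 / 10 + x 2 := by have := (abs_le.1 (hx 2)).1; linarith
  have s2 : 0 ≤ 9 / 10 - x 2 := by have := (abs_le.1 (hx 2)).2; linarith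
  have a3 : 0 ≤ 9 / 10 + x 3 := by have := (abs_le.1 (hx 3)).1; linarith
  have s3 : 0 ≤ 9 / 10 - x 3 := by have := (abs_le.1 (hx 3)).2; linarith
  simp only [deg2_A_q13_Vz, deg2_A_q13_V_eq, deg2_A_q13_level]
  linarith [mul_nonneg s0 a0, mul_nonneg s1 a1, mul_nonneg s2 a2, mul_nonneg s3 a3, mul_nonneg s0 a1,
    mul_nonneg a0 s1, mul_nonneg s0 s1, mul_nonneg a0 a1, mul_nonneg s0 a2, mul_nonneg a0 s2,
    mul_nonneg s0 s2, mul_nonneg a0 a2, mul_nonneg s0 a3, mul_nonneg a0 s3, mul_nonneg s0 s3,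
    mul_nonneg a0 a3, mul_nonneg s1 a2, mul_nonneg a1 s2, mul_nonneg s1 s2, mul_nonneg a1 a2,
    mul_nonneg s1 a3, mul_nonneg a1 s3, mul_nonneg s1 s3, mul_nonneg a1 a3, mul_nonneg s2 a3,
    mul_nonneg a2 s3, mul_nonneg s2 s3, mul_nonneg a2 a3]

/-- **Box form of the network sentence.** Every solution of «DVOC2-GCBD19-13» on `[0, ∞)` whose
initial invariants are each within `9/10` of `r⋆ = (1, 1, ξ⋆, ζ⋆)` has `invariants v̂(t) → r⋆`.
MODELLED: MV-6O + MV-κ(κ′) + MV-P + N2-restriction(-13). No stability word. [folklore] -/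
theorem deg2_A_q13_orbit_roa_of_box {v : ℝ → State 2} (hv : gcbd19n13.IsSolutionOn v (Ici 0))
    (h0 : ∀ i, |(invariants (v 0) - rstar) i| ≤ 9 / 10) :
    Tendsto (fun t => invariants (v t)) atTop (𝓝 rstar) :=
  (deg2_A_q13_orbit_roa hv (deg2_A_q13_Vz_le_level_of_box h0)).2

end Summit.Ventures.GridStability.Models.InverterDVOC.DvocNetwork.gcbd19n13

end
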